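/-
Copyright (c) 2026 the pub-hodgecm-mathlib formalisation cell (harness21).  Prover seat hodgecm-mathlib-K2Liu-p14 (g6) (K1b desk), Track B «K2-LIT»,
#184♮ = hLiu418 = `stmt-HodgeConjecture-24832`; socket #41, KIND 1, package (K1b-♮), letter (dec-2-pay) F2γ «TENSOR FUBINI ON THE LINE» (LH4-p14 (g9) F2 BLUEPRINT
dd6a402ca97d3cd0 item (3); LEAD F0P6-plan (g16) BATCH #304 (1) ∕ #309).  THEOREMS ONLY (no `def`, no `instance`, no notation, no named-fact hypothesis, no `sorry`).
-/
import Summits.HodgeConjecture.HodgeConjecture.Theorems.K2LiuKindWJointIntegrable                -- ★ (x-a-int) `integrable_tensor_prod_pi` (⊇ ★ (x-a) `kindWPart`, ★ p862531 `K2LiuSiegelEisensteinKindWPartFubini`)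
import Summits.HodgeConjecture.HodgeConjecture.Theorems.K2LiuArchUnipotentHaarTransport         -- ★ FILE 11 `isFiniteMeasureOnCompacts_map`, `isAddLeftInvariant_map_of_mulHom`
import Mathlib.MeasureTheory.Integral.Pi
import HarnessLib

/-!
# Crux `HLiu418`, socket #41, KIND 1 ∕ (K1b-♮), (dec-2-pay) F2γ — `K2LiuKindOneLineTensorFubini`: THE `T`-PART WHITTAKER INTEGRAL OF A FINITE SUM OF PURE TENSORS
# SPLITS UNDER FACTORWISE INTEGRABILITY, and the generic measure-theoretic letters the presentation assembler reads

Cell `hodgecm-mathlib`, crux item hLiu418 = `stmt-HodgeConjecture-24832` (helper lane `--supports … --as helper`, count-neutral), route of record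
`HCCMUnconditional`; squad K2 ∕ K2Liu, socket #41, KIND 1, package (K1b-♮); K1b desk K2Liu-p14 (g6).  F2 = the payer of the line chains `hchain₁ ∕ hchain₀` of ★ p865283 ∕
★ p865308 (F1 ED. 3); LH4-p14 (g9)'s F2 BLUEPRINT (2026-09-05, dd6a402ca97d3cd0) item (3): after F2α (`W = kindWPart(T*, νinf, νv, F♯, Sℓ, s′, 1)·(L^{U*})⁻¹`) the
assembler needs `kindWPart(…, F♯, …) = Σ_i (∫_{N_arch} conj ψ · Finf♯_i) · ∏_{v∈T*} (∫_{N_v} conj ψ_v · Fv♯_{i,v})` — ★ `jointWhittaker_eq_sum_mul_prod_of_sum_tensor` — with its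
JOINT integrability letter `hint` paid from the letters the line actually owns: ARCHIMEDEAN integrability per summand (`harch`'s per-component `hint` × F2ζ's
coordinates) and LOCAL integrability per summand and place (★ F3-loc `K2LiuKindOneLineLocalAbsoluteMajorant.integrable_and_norm_integral_le`).  THIS FILE (all generic, no
K1b design decision inside):
* §1 `integrable_sum_tensor_of_factors` — the finite-Σ twin of ★ (x-a-int) `K2LiuKindWJointIntegrable.integrable_tensor_prod_pi` (on `μ ⊗ ⊗ᵢ νᵢ`: `φ·g_j` integrable on
  `μ` and every `ψᵢ·k_{j,i}` integrable on `νᵢ` ⇒ the joint integrand of `Σ_j g_j ⊗ (⊗ᵢ k_{j,i})` against `φ ⊗ (⊗ᵢ ψᵢ)` is integrable).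
* §2 **`kindWPart_eq_sum_mul_prod_of_factors`** — ★ (x-a) `kindWPart T νinf νv fT S s h` for `fT = Σ_j Finf_j ⊗ (⊗_{v∈T} Fv_{j,v})` EQUALS
  `Σ_j (∫ conj ψ_S(a) · Finf_j(s)(w_Δ a h_∞) dνinf) · ∏_{v∈T} ∫ conj ψ_S(ι_v y) · Fv_{j,v}(s)((w_Δ)_v y h_v) dνv`, the joint letter `hint` of ★ Fubini REPLACED by the
  factorwise letters `hintA` (archimedean, per `j`; the conclusion shape of ★ `K2LiuKindOneArchLetterIntegrable.hintArch_of_isArchSiegelSection`) and `hintV` (local, per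
  `(j, v)`; the conclusion shape of ★ `K2LiuKindWFiniteLetterIntegrable.integrable_conj_unipDeltaChar_mul_of_isLocalSiegelSection`).  Generic frame binders
  `(e : Fin N × Fin M ≃ Fin n) dV hdV dW hdW` — the line reads it at `e := eB`, KIND W at `n = 2`.
* §3 `sum_mul_prod_coe_mul_prod_sdiff` (+ the dependent-index twin `…_sdiff'`) — the Finset algebra that turns ★ `isFactorizableOff_cornerTranslate`'s explicit `fT′`
  (`(Σ_i a_i ∏_{v∈T} b_{i,v}) · ∏_{v∈T′∖T} c_v`) into ONE `T′`-indexed Σ⊗ presentation `Σ_i a_i ∏_{v∈T′} (if v ∈ T then b_{i,v} else c_v)` (the `hsum` of §2 at `T := T*`).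
* §4 `map_eq_addHaarScalarFactor_smul`, `integral_comp_eq_addHaarScalarFactor_smul`, **`integrable_comp_of_integrable_addHaar`** — ★ FILE 11's Haar transport with the
  constant NAMED (`c = addHaarScalarFactor (Φ_* ν) μ`) and its integrability half: `G` integrable for the additive Haar measure ⇒ `G ∘ Φ` integrable for `ν` (for F2ζ's
  `N^{(B)}_arch ≅ ∏_σ ℝ`: the archimedean letter `hintA` from per-coordinate integrability, no line Iwasawa datum needed).
* §5 rank-one real coordinates: `integral_pi_prod_eq_prod_integral` ∕ `integrable_pi_prod` (Fubini ∕ Tonelli on `Sinf → ℝ` for ⊗-pure integrands, Mathlib), and the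
  `1 × 1`-matrix coordinate of ★ FILE 12 `exists_integral_frame_eq_smul` at `n = 1`: `integral_matrixFinOne_eq` (`∫_{ℝ^{1×1}} G(r 0 0) dr = ∫_ℝ G`),
  `integral_pi_matrixFinOne_prod_eq` (`∫_{∏_σ ℝ^{1×1}} ∏_σ G_σ(r_σ 0 0) = ∏_σ ∫_ℝ G_σ`), `integrable_pi_matrixFinOne_prod`.
NOT HERE: F2α (Euler at the corner translate, LH4-p09 (g11)), F2β∕F2δ (frame readings, ★ p865320 ∕ p865405), F2ζ (the arch product on the line), F2η (σ-tensor
presentation of the arch factor), `harch`'s payer, the assembler (LH4-p14 (g9)).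
HONEST LABEL.  Count-neutral helper; closes no socket: `HC_CM` is proved only modulo the 7 printed citations (2 remaining named inputs: hLiu418 =
`stmt-HodgeConjecture-24832`, h413 = `stmt-HodgeConjecture-24833`) until rung 0 closes.

## References
* [KudlaRallis1994] S. Kudla, S. Rallis, Ann. of Math. 140 (1994): §1 (a non-singular Fourier coefficient of a factorizable section is a product of local Whittaker integrals).
* [Tan1999] V. Tan, Canad. J. Math. 51 (1999): §2–§3.
* [CasselsFrohlichANT1967] Cassels–Fröhlich (eds.), *Algebraic Number Theory* (1967): Ch. XV (Tate) §3.3 (Fubini on finite products of local fields).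
* [Folland1995] G. B. Folland, *A Course in Abstract Harmonic Analysis* (1995): §2.2 (uniqueness of Haar measure), §2.3 (product measures, Fubini–Tonelli).
-/

set_option autoImplicit false
-- the mandated namespace repeats the single-problem summit's segment (`HodgeConjecture.HodgeConjecture`)
set_option linter.dupNamespace false

noncomputable section

open scoped Matrix ENNReal NNReal Topology ComplexConjugate BigOperators
open NumberField IsDedekindDomain MeasureTheory Measure Filter Set

namespace Summit.HodgeConjecture.HodgeConjecture.Cruxes.HLiu418.K2LiuKindOneLineTensorFubini

open Summit.HodgeConjecture.HodgeConjecture.Cruxes.HLiu418.K2LiuSiegelEisensteinKindWPartFubini (integral_prod_pi_tensor jointWhittaker_eq_sum_mul_prod_of_sum_tensor)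
open Summit.HodgeConjecture.HodgeConjecture.Cruxes.HLiu418.K2LiuArchUnipotentHaarTransport (isFiniteMeasureOnCompacts_map isAddLeftInvariant_map_of_mulHom)
open Summit.HodgeConjecture.HodgeConjecture.Cruxes.HLiu418.K2LiuKindWJointIntegrable (integrable_tensor_prod_pi)

/-! ## §1 Factorwise integrability ⇒ integrability of a finite sum of pure tensors on `μ ⊗ ⊗ᵢ νᵢ` (★ (x-a-int) `integrable_tensor_prod_pi`, summed) -/

section Generic

variable {X : Type*} [MeasurableSpace X] {ι : Type*} [Fintype ι] {Y : ι → Type*} [∀ i, MeasurableSpace (Y i)]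
  (μ : Measure X) (ν : ∀ i, Measure (Y i)) [∀ i, SigmaFinite (ν i)]

/-- **FACTORWISE INTEGRABILITY ⇒ JOINT INTEGRABILITY OF A FINITE SUM OF PURE TENSORS**: if every summand's factors are integrable (`φ·g_j` on `μ`, `ψᵢ·k_{j,i}`
on `νᵢ`), the joint integrand of `Σ_j g_j ⊗ (⊗ᵢ k_{j,i})` against `φ ⊗ (⊗ᵢ ψᵢ)` is integrable on `μ ⊗ ⊗ᵢ νᵢ` (★ `integrable_tensor_prod_pi` per summand, `integrable_finsetSum`).
[cite: Folland1995, §2.3] -/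
theorem integrable_sum_tensor_of_factors (φ : X → ℂ) (ψ : ∀ i, Y i → ℂ) {m : ℕ} (g : Fin m → X → ℂ) (k : Fin m → ∀ i, Y i → ℂ)
    (hA : ∀ j, Integrable (fun x => φ x * g j x) μ) (hV : ∀ j i, Integrable (fun y => ψ i y * k j i y) (ν i)) :
    Integrable (fun p : X × (∀ i, Y i) => (φ p.1 * ∏ i, ψ i (p.2 i)) * (∑ j, g j p.1 * ∏ i, k j i (p.2 i))) (μ.prod (Measure.pi ν)) := by
  have h1 : (fun p : X × (∀ i, Y i) => (φ p.1 * ∏ i, ψ i (p.2 i)) * (∑ j, g j p.1 * ∏ i, k j i (p.2 i))) =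
      fun p => ∑ j, (φ p.1 * ∏ i, ψ i (p.2 i)) * (g j p.1 * ∏ i, k j i (p.2 i)) := by
    funext p
    rw [Finset.mul_sum]
  rw [h1]
  exact integrable_finsetSum _ fun j _ => integrable_tensor_prod_pi μ ν φ (g j) ψ (k j) (hA j) (hV j)

end Generic

/-! ## §2 `kindWPart` of a finite sum of pure tensors under FACTORWISE integrability -/

section Whittaker

open Literature.NumberTheory.Automorphic Literature.NumberTheory.GaloisRepresentations
open Literature.NumberTheory.GelbartRogawski1991 Literature.NumberTheory.GelbartRogawski1991.GRConstruction
open Literature.NumberTheory.K2Lit.SiegelDoubled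
open Literature.NumberTheory.K2Lit.PlaceSplitting
open Summit.HodgeConjecture.HodgeConjecture.Cruxes.HLiu418.K2LiuSiegelUnipotentLocalDefs
open Summit.HodgeConjecture.HodgeConjecture.Cruxes.HLiu418.K2LiuSiegelUnipotentSplitDefs
open Summit.HodgeConjecture.HodgeConjecture.Cruxes.HLiu418.K2LiuSiegelUnipotentSplitAtDefs
open Summit.HodgeConjecture.HodgeConjecture.Cruxes.HLiu418.K2LiuSiegelUnipotentFourierDefs
open Summit.HodgeConjecture.HodgeConjecture.Cruxes.HLiu418.K2LiuSiegelEisensteinKindWLetters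

variable (L : Type) [Field L] [NumberField L] [IsCMField L]
variable {N M n : ℕ} (e : Fin N × Fin M ≃ Fin n)
  (dV : Fin N → L) (hdV : ∀ i, IsCMField.complexConj L (dV i) = dV i)
  (dW : Fin M → L) (hdW : ∀ i, IsCMField.complexConj L (dW i) = dW i)
  [MeasurableSpace ↥(unipDeltaArch L e dV hdV dW hdW)]
  [∀ v : HeightOneSpectrum (𝓞 (Fp L)), MeasurableSpace ↥(unipDeltaLoc L e dV hdV dW hdW v)]

set_option maxHeartbeats 400000 in -- MEASURED (as ★ `jointWhittaker_eq_sum_mul_prod_of_sum_tensor`, whose statement this one repeats: the default 200 000 times out at `isDefEq` of the final `exact`); plain `unfold` + `exact`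
/-- **`kindWPart` OF A FINITE SUM OF PURE TENSORS, FACTORWISE INTEGRABILITY.**  If the `T`-part is `fT_s(a, x) = Σ_{j<m} F_{∞,j}(s)(a) · ∏_{v∈T} F_{v,j}(s)(x_v)` (`hsum`),
every archimedean Whittaker integrand `a ↦ conj ψ_S(a) · F_{∞,j}(s)(w_Δ a h_∞)` is `νinf`-integrable (`hintA`) and every local one `y ↦ conj ψ_S(ι_v y) · F_{v,j}(s)((w_Δ)_v y h_v)`
is `νv v`-integrable (`hintV`), then ★ (x-a) `kindWPart T νinf νv fT S s h = I_T(S,s,h)` equals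
`Σ_j (∫ conj ψ_S(a) · F_{∞,j}(s)(w_Δ a h_∞) dνinf) · ∏_{v∈T} ∫ conj ψ_S(ι_v y) · F_{v,j}(s)((w_Δ)_v y h_v) dνv`
(★ `jointWhittaker_eq_sum_mul_prod_of_sum_tensor`, its joint letter `hint` paid per summand by ★ (x-a-int) `integrable_tensor_prod_pi`). [cite: KudlaRallis1994, §1] [cite: Tan1999, §2–§3] [cite: CasselsFrohlichANT1967, Ch. XV §3.3] -/
theorem kindWPart_eq_sum_mul_prod_of_factors (T : Finset (HeightOneSpectrum (𝓞 (Fp L))))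
    (νinf : Measure ↥(unipDeltaArch L e dV hdV dW hdW)) [SFinite νinf]
    (νv : ∀ v : HeightOneSpectrum (𝓞 (Fp L)), Measure ↥(unipDeltaLoc L e dV hdV dW hdW v)) [∀ v, SigmaFinite (νv v)]
    {fT : ℂ → UnitaryGroup.arch (Fp L) L (IsCMField.complexConj L) (n + n) (hermD L e dV hdV dW hdW) ×
      (Π v : T, UnitaryGroup.localPi L (IsCMField.complexConj L) (n + n) (hermD L e dV hdV dW hdW) v.1) → ℂ} {m : ℕ}
    {Finf : Fin m → ℂ → UnitaryGroup.arch (Fp L) L (IsCMField.complexConj L) (n + n) (hermD L e dV hdV dW hdW) → ℂ}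
    {Fv : Fin m → ∀ v : T, ℂ → UnitaryGroup.localPi L (IsCMField.complexConj L) (n + n) (hermD L e dV hdV dW hdW) v.1 → ℂ}
    (hsum : ∀ (s : ℂ) (a : UnitaryGroup.arch (Fp L) L (IsCMField.complexConj L) (n + n) (hermD L e dV hdV dW hdW))
      (x : Π v : T, UnitaryGroup.localPi L (IsCMField.complexConj L) (n + n) (hermD L e dV hdV dW hdW) v.1),
      fT s (a, x) = ∑ j, Finf j s a * ∏ v : T, Fv j v s (x v))
    (S : Matrix (Fin n) (Fin n) L) (s : ℂ) (h : HA L e dV hdV dW hdW)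
    (hintA : ∀ j, Integrable (fun a : ↥(unipDeltaArch L e dV hdV dW hdW) =>
      (conj (unipDeltaChar L e dV hdV dW hdW S
            (UnitaryGroup.archToAdelic (Fp L) L (IsCMField.complexConj L) (n + n) (hermD L e dV hdV dW hdW)
              (a : UnitaryGroup.arch (Fp L) L (IsCMField.complexConj L) (n + n) (hermD L e dV hdV dW hdW))) : ℂ) *
        Finf j s (UnitaryGroup.archPart (Fp L) L (IsCMField.complexConj L) (n + n) (hermD L e dV hdV dW hdW) (weylDelta L e dV hdV dW hdW) *
              (a : UnitaryGroup.arch (Fp L) L (IsCMField.complexConj L) (n + n) (hermD L e dV hdV dW hdW)) *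
              UnitaryGroup.archPart (Fp L) L (IsCMField.complexConj L) (n + n) (hermD L e dV hdV dW hdW) h))) νinf)
    (hintV : ∀ j (v : T), Integrable (fun y : ↥(unipDeltaLoc L e dV hdV dW hdW v.1) =>
      (conj (unipDeltaChar L e dV hdV dW hdW S
            (locToAdelic L e dV hdV dW hdW v.1
              ((y : ↥(unipDeltaLoc L e dV hdV dW hdW v.1)) : UnitaryGroup.localPi L (IsCMField.complexConj L) (n + n) (hermD L e dV hdV dW hdW) v.1)) : ℂ) *
        Fv j v s (UnitaryGroup.evalPlace (Fp L) L (IsCMField.complexConj L) (n + n) (hermD L e dV hdV dW hdW) v.1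
              (UnitaryGroup.finPart (Fp L) L (IsCMField.complexConj L) (n + n) (hermD L e dV hdV dW hdW) (weylDelta L e dV hdV dW hdW)) *
            ((y : ↥(unipDeltaLoc L e dV hdV dW hdW v.1)) : UnitaryGroup.localPi L (IsCMField.complexConj L) (n + n) (hermD L e dV hdV dW hdW) v.1) *
            UnitaryGroup.evalPlace (Fp L) L (IsCMField.complexConj L) (n + n) (hermD L e dV hdV dW hdW) v.1
              (UnitaryGroup.finPart (Fp L) L (IsCMField.complexConj L) (n + n) (hermD L e dV hdV dW hdW) h)))) (νv v.1)) :
    kindWPart L e dV hdV dW hdW T νinf νv fT S s h =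
      ∑ j, (∫ a, conj (unipDeltaChar L e dV hdV dW hdW S
            (UnitaryGroup.archToAdelic (Fp L) L (IsCMField.complexConj L) (n + n) (hermD L e dV hdV dW hdW)
              (a : UnitaryGroup.arch (Fp L) L (IsCMField.complexConj L) (n + n) (hermD L e dV hdV dW hdW))) : ℂ) *
          Finf j s (UnitaryGroup.archPart (Fp L) L (IsCMField.complexConj L) (n + n) (hermD L e dV hdV dW hdW) (weylDelta L e dV hdV dW hdW) *
              (a : UnitaryGroup.arch (Fp L) L (IsCMField.complexConj L) (n + n) (hermD L e dV hdV dW hdW)) *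
              UnitaryGroup.archPart (Fp L) L (IsCMField.complexConj L) (n + n) (hermD L e dV hdV dW hdW) h) ∂νinf) *
        ∏ v : T, ∫ y, conj (unipDeltaChar L e dV hdV dW hdW S
            (locToAdelic L e dV hdV dW hdW v.1
              ((y : ↥(unipDeltaLoc L e dV hdV dW hdW v.1)) : UnitaryGroup.localPi L (IsCMField.complexConj L) (n + n) (hermD L e dV hdV dW hdW) v.1)) : ℂ) *
          Fv j v s (UnitaryGroup.evalPlace (Fp L) L (IsCMField.complexConj L) (n + n) (hermD L e dV hdV dW hdW) v.1
                (UnitaryGroup.finPart (Fp L) L (IsCMField.complexConj L) (n + n) (hermD L e dV hdV dW hdW) (weylDelta L e dV hdV dW hdW)) *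
              ((y : ↥(unipDeltaLoc L e dV hdV dW hdW v.1)) : UnitaryGroup.localPi L (IsCMField.complexConj L) (n + n) (hermD L e dV hdV dW hdW) v.1) *
              UnitaryGroup.evalPlace (Fp L) L (IsCMField.complexConj L) (n + n) (hermD L e dV hdV dW hdW) v.1
                (UnitaryGroup.finPart (Fp L) L (IsCMField.complexConj L) (n + n) (hermD L e dV hdV dW hdW) h)) ∂(νv v.1) := by
  unfold kindWPart
  exact jointWhittaker_eq_sum_mul_prod_of_sum_tensor L e dV hdV dW hdW T νinf νv hsum S s h fun j =>
    integrable_tensor_prod_pi νinf (fun v : T => νv v.1)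
      (fun a => conj (unipDeltaChar L e dV hdV dW hdW S
        (UnitaryGroup.archToAdelic (Fp L) L (IsCMField.complexConj L) (n + n) (hermD L e dV hdV dW hdW)
          (a : UnitaryGroup.arch (Fp L) L (IsCMField.complexConj L) (n + n) (hermD L e dV hdV dW hdW))) : ℂ))
      (fun a => Finf j s (UnitaryGroup.archPart (Fp L) L (IsCMField.complexConj L) (n + n) (hermD L e dV hdV dW hdW) (weylDelta L e dV hdV dW hdW) *
        (a : UnitaryGroup.arch (Fp L) L (IsCMField.complexConj L) (n + n) (hermD L e dV hdV dW hdW)) *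
        UnitaryGroup.archPart (Fp L) L (IsCMField.complexConj L) (n + n) (hermD L e dV hdV dW hdW) h))
      (fun (v : T) (y : ↥(unipDeltaLoc L e dV hdV dW hdW v.1)) => conj (unipDeltaChar L e dV hdV dW hdW S
        (locToAdelic L e dV hdV dW hdW v.1
          ((y : ↥(unipDeltaLoc L e dV hdV dW hdW v.1)) : UnitaryGroup.localPi L (IsCMField.complexConj L) (n + n) (hermD L e dV hdV dW hdW) v.1)) : ℂ))
      (fun (v : T) (y : ↥(unipDeltaLoc L e dV hdV dW hdW v.1)) =>
        Fv j v s (UnitaryGroup.evalPlace (Fp L) L (IsCMField.complexConj L) (n + n) (hermD L e dV hdV dW hdW) v.1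
            (UnitaryGroup.finPart (Fp L) L (IsCMField.complexConj L) (n + n) (hermD L e dV hdV dW hdW) (weylDelta L e dV hdV dW hdW)) *
          ((y : ↥(unipDeltaLoc L e dV hdV dW hdW v.1)) : UnitaryGroup.localPi L (IsCMField.complexConj L) (n + n) (hermD L e dV hdV dW hdW) v.1) *
          UnitaryGroup.evalPlace (Fp L) L (IsCMField.complexConj L) (n + n) (hermD L e dV hdV dW hdW) v.1
            (UnitaryGroup.finPart (Fp L) L (IsCMField.complexConj L) (n + n) (hermD L e dV hdV dW hdW) h)))
      (hintA j) (fun v => hintV j v)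

end Whittaker

/-! ## §3 The Finset algebra of the translated corner's `T′`-part: one `T′`-indexed Σ⊗ presentation -/

section FinsetAlgebra

variable {α : Type*} [DecidableEq α] {κ : Type*} [Fintype κ] {R : Type*} [CommRing R]

/-- **ONE `T′`-INDEXED PRESENTATION**: for `T ⊆ T′`,
`(Σ_i a_i · ∏_{v∈T} b_i v) · ∏_{v ∈ T′∖T} c v = Σ_i a_i · ∏_{v∈T′} (if v ∈ T then b_i v else c v)` — the shape of ★ `isFactorizableOff_cornerTranslate`'s `fT′`
(the `T`-part's Σ⊗ expansion times the `T′∖T` spherical tail) rewritten as the `hsum` of §2 at `T := T′`. [folklore] -/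
theorem sum_mul_prod_coe_mul_prod_sdiff {T T' : Finset α} (hTT' : T ⊆ T') (a : κ → R) (b : κ → α → R) (c : α → R) :
    (∑ i, a i * ∏ v : ↥T, b i v.1) * ∏ v ∈ T' \ T, c v = ∑ i, a i * ∏ v : ↥T', (if v.1 ∈ T then b i v.1 else c v.1) := by
  rw [Finset.sum_mul]
  refine Finset.sum_congr rfl fun i _ => ?_
  rw [mul_assoc]
  congr 1
  rw [Finset.prod_coe_sort T (fun v => b i v), Finset.prod_coe_sort T' (fun v => if v ∈ T then b i v else c v), ← Finset.prod_sdiff hTT', mul_comm]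
  congr 1
  · exact Finset.prod_congr rfl fun v hv => by rw [if_neg (Finset.mem_sdiff.1 hv).2]
  · exact Finset.prod_congr rfl fun v hv => by rw [if_pos hv]

/-- **dependent-index twin**: the `T`-factors may be given on the larger index type `↥T′` (as they are when the `T`-tuple is read off a `T′`-tuple),
`(Σ_i a_i · ∏_{v : T} B_i ⟨v, _⟩) · ∏_{v ∈ T′∖T} c v = Σ_i a_i · ∏_{v : T′} (if v ∈ T then B_i v else c v)`. [folklore] -/
theorem sum_mul_prod_coe_mul_prod_sdiff' {T T' : Finset α} (hTT' : T ⊆ T') (a : κ → R) (B : κ → ↥T' → R) (c : α → R) :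
    (∑ i, a i * ∏ v : ↥T, B i ⟨v.1, hTT' v.2⟩) * ∏ v ∈ T' \ T, c v = ∑ i, a i * ∏ v : ↥T', (if v.1 ∈ T then B i v else c v.1) := by
  -- extend `B i` to a function on `α` (zero off `T′`) and apply the non-dependent form
  have key := sum_mul_prod_coe_mul_prod_sdiff hTT' a (fun i v => if hv : v ∈ T' then B i ⟨v, hv⟩ else 0) c
  have hT : ∀ i, (∏ v : ↥T, (fun i v => if hv : v ∈ T' then B i ⟨v, hv⟩ else 0) i v.1) = ∏ v : ↥T, B i ⟨v.1, hTT' v.2⟩ := fun i =>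
    Finset.prod_congr rfl fun v _ => by simp only [dif_pos (hTT' v.2)]
  have hT' : ∀ i, (∏ v : ↥T', (if v.1 ∈ T then (fun i v => if hv : v ∈ T' then B i ⟨v, hv⟩ else 0) i v.1 else c v.1)) =
      ∏ v : ↥T', (if v.1 ∈ T then B i v else c v.1) := fun i =>
    Finset.prod_congr rfl fun v _ => by simp only [dif_pos v.2, Subtype.coe_eta]
  simp only [hT, hT'] at key
  exact key

end FinsetAlgebra

/-! ## §4 Haar transport with the constant named; the integrability half -/

section Transport

variable {Ngp : Type*} [Group Ngp] [TopologicalSpace Ngp] [ContinuousMul Ngp] [MeasurableSpace Ngp] [BorelSpace Ngp]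
  {E : Type*} [AddGroup E] [TopologicalSpace E] [IsTopologicalAddGroup E] [MeasurableSpace E] [BorelSpace E]
  [T2Space E] [LocallyCompactSpace E] [SecondCountableTopology E]

/-- **THE PUSH-FORWARD IS A NAMED MULTIPLE OF THE ADDITIVE HAAR MEASURE**: `Φ_* ν = addHaarScalarFactor(Φ_* ν, μ) • μ` for `Φ : N ≃ₜ E` turning products into sums,
`ν` left-invariant and finite on compacts, `μ` an additive Haar measure (★ FILE 11's two instances + Mathlib `isAddLeftInvariant_eq_smul`). [cite: Folland1995, §2.2] -/
theorem map_eq_addHaarScalarFactor_smul (μ : Measure E) [μ.IsAddHaarMeasure]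
    (Φ : Ngp ≃ₜ E) (hΦ : ∀ u v : Ngp, Φ (u * v) = Φ u + Φ v) (ν : Measure Ngp) [IsFiniteMeasureOnCompacts ν] [ν.IsMulLeftInvariant] :
    Measure.map Φ ν = (haveI := isFiniteMeasureOnCompacts_map Φ ν; haveI := isAddLeftInvariant_map_of_mulHom Φ hΦ ν;
      addHaarScalarFactor (Measure.map Φ ν) μ) • μ := by
  haveI := isFiniteMeasureOnCompacts_map Φ ν
  haveI := isAddLeftInvariant_map_of_mulHom Φ hΦ ν
  exact isAddLeftInvariant_eq_smul (Measure.map Φ ν) μ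

/-- **INTEGRABILITY TRANSPORTS**: with `Φ, ν, μ` as above, a `μ`-integrable `G : E → F` has `ν`-integrable pull-back `u ↦ G (Φ u)` (the integrability half of ★ FILE 11
`exists_integral_comp_eq_smul`; used for the archimedean letter `hintA` of §2 on the line: `N^{(B)}_arch ≅ ∏_σ ℝ`). [cite: Folland1995, §2.2] -/
theorem integrable_comp_of_integrable_addHaar (μ : Measure E) [μ.IsAddHaarMeasure]
    (Φ : Ngp ≃ₜ E) (hΦ : ∀ u v : Ngp, Φ (u * v) = Φ u + Φ v) (ν : Measure Ngp) [IsFiniteMeasureOnCompacts ν] [ν.IsMulLeftInvariant]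
    {F : Type*} [NormedAddCommGroup F] {G : E → F} (hG : Integrable G μ) :
    Integrable (fun u => G (Φ u)) ν := by
  have hmap := map_eq_addHaarScalarFactor_smul μ Φ hΦ ν
  have h1 : Integrable G (Measure.map Φ ν) := by
    rw [hmap]
    exact hG.smul_measure_nnreal
  exact (Φ.measurableEmbedding.integrable_map_iff).1 h1

/-- **THE INTEGRAL IDENTITY WITH THE SAME NAMED CONSTANT**: `∫ G (Φ u) dν = addHaarScalarFactor(Φ_* ν, μ) • ∫ G dμ` for every `G` (★ FILE 11 with its `∃ c` opened; one
constant for the identity and for every integrand). [cite: Folland1995, §2.2] -/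
theorem integral_comp_eq_addHaarScalarFactor_smul (μ : Measure E) [μ.IsAddHaarMeasure]
    (Φ : Ngp ≃ₜ E) (hΦ : ∀ u v : Ngp, Φ (u * v) = Φ u + Φ v) (ν : Measure Ngp) [IsFiniteMeasureOnCompacts ν] [ν.IsMulLeftInvariant]
    {F : Type*} [NormedAddCommGroup F] [NormedSpace ℝ F] (G : E → F) :
    ∫ u, G (Φ u) ∂ν = (haveI := isFiniteMeasureOnCompacts_map Φ ν; haveI := isAddLeftInvariant_map_of_mulHom Φ hΦ ν;
      addHaarScalarFactor (Measure.map Φ ν) μ) • ∫ x, G x ∂μ := by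
  have hmap := map_eq_addHaarScalarFactor_smul μ Φ hΦ ν
  rw [← Φ.measurableEmbedding.integral_map]
  calc ∫ y, G y ∂(Measure.map Φ ν) = ∫ y, G y ∂((haveI := isFiniteMeasureOnCompacts_map Φ ν; haveI := isAddLeftInvariant_map_of_mulHom Φ hΦ ν;
      addHaarScalarFactor (Measure.map Φ ν) μ) • μ) := by rw [← hmap]
    _ = _ := integral_smul_nnreal_measure _ _

end Transport

/-! ## §5 Rank-one real coordinates: Fubini on `Sinf → ℝ` and the `1 × 1`-matrix coordinate of ★ FILE 12 at `n = 1` -/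

section RealCoordinates

variable {σT : Type*} [Fintype σT]

/-- **Fubini on `∏_σ ℝ` for a ⊗-pure integrand** (Mathlib `integral_fintype_prod_volume_eq_prod`, recorded in the shape F2ζ reads):
`∫_{Sinf → ℝ} ∏_σ G_σ(t_σ) dt = ∏_σ ∫_ℝ G_σ`. [cite: Folland1995, §2.3] -/
theorem integral_pi_prod_eq_prod_integral (G : σT → ℝ → ℂ) :
    ∫ t : σT → ℝ, ∏ σ, G σ (t σ) = ∏ σ, ∫ x : ℝ, G σ x :=
  integral_fintype_prod_volume_eq_prod G

/-- **Tonelli half**: integrable factors ⇒ the ⊗-pure integrand is integrable on `Sinf → ℝ` (Mathlib `Integrable.fintype_prod`). [cite: Folland1995, §2.3] -/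
theorem integrable_pi_prod {G : σT → ℝ → ℂ} (hG : ∀ σ, Integrable (G σ)) :
    Integrable (fun t : σT → ℝ => ∏ σ, G σ (t σ)) := by
  rw [volume_pi]
  exact Integrable.fintype_prod hG

/-- **the `1 × 1`-matrix coordinate**: `∫_{ℝ^{1×1}} G(r 0 0) dr = ∫_ℝ G` (Mathlib `volume_preserving_funUnique` twice: the volume-preserving `Fin 1 → Fin 1 → ℝ ≃ᵐ Fin 1 → ℝ ≃ᵐ ℝ`, `r ↦ r 0 0` definitionally).
[cite: Folland1995, §2.3] -/
theorem integral_matrixFinOne_eq {F : Type*} [NormedAddCommGroup F] [NormedSpace ℝ F] (G : ℝ → F) :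
    ∫ r : Fin 1 → Fin 1 → ℝ, G (r 0 0) = ∫ x : ℝ, G x := by
  have h := ((volume_preserving_funUnique (Fin 1) (Fin 1 → ℝ)).trans (volume_preserving_funUnique (Fin 1) ℝ)).integral_comp' (g := G)
  exact h

/-- **integrability in the `1 × 1`-matrix coordinate**: `r ↦ G (r 0 0)` is integrable on `ℝ^{1×1}` iff … — the direction used: `G` integrable on `ℝ` ⇒ integrable pull-back.
[cite: Folland1995, §2.3] -/
theorem integrable_matrixFinOne {F : Type*} [NormedAddCommGroup F] {G : ℝ → F} (hG : Integrable G) :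
    Integrable (fun r : Fin 1 → Fin 1 → ℝ => G (r 0 0)) := by
  have h := (((volume_preserving_funUnique (Fin 1) (Fin 1 → ℝ)).trans (volume_preserving_funUnique (Fin 1) ℝ)).integrable_comp_emb
    (MeasurableEquiv.measurableEmbedding _)).2 hG
  exact h

/-- **`∫_{∏_σ ℝ^{1×1}} ∏_σ G_σ(r_σ 0 0) dr = ∏_σ ∫_ℝ G_σ`** — ★ FILE 12 `exists_integral_frame_eq_smul`'s right-hand side at `n = 1` for a ⊗-pure `Ψ`, read as a product
of real line integrals (Fubini over `σ`, then the `1 × 1` coordinate per factor). [cite: Folland1995, §2.3] -/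
theorem integral_pi_matrixFinOne_prod_eq (G : σT → ℝ → ℂ) :
    ∫ r : σT → (Fin 1 → Fin 1 → ℝ), ∏ σ, G σ (r σ 0 0) = ∏ σ, ∫ x : ℝ, G σ x := by
  rw [integral_fintype_prod_volume_eq_prod (fun σ (rσ : Fin 1 → Fin 1 → ℝ) => G σ (rσ 0 0))]
  exact Finset.prod_congr rfl fun σ _ => integral_matrixFinOne_eq (G σ)

/-- **Tonelli half in the `1 × 1` coordinates**: integrable factors ⇒ `r ↦ ∏_σ G_σ(r_σ 0 0)` integrable on `∏_σ ℝ^{1×1}`. [cite: Folland1995, §2.3] -/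
theorem integrable_pi_matrixFinOne_prod {G : σT → ℝ → ℂ} (hG : ∀ σ, Integrable (G σ)) :
    Integrable (fun r : σT → (Fin 1 → Fin 1 → ℝ) => ∏ σ, G σ (r σ 0 0)) := by
  rw [volume_pi]
  exact Integrable.fintype_prod (f := fun σ (rσ : Fin 1 → Fin 1 → ℝ) => G σ (rσ 0 0)) fun σ => integrable_matrixFinOne (hG σ)

end RealCoordinates

end Summit.HodgeConjecture.HodgeConjecture.Cruxes.HLiu418.K2LiuKindOneLineTensorFubini

end
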